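import Summits.CriticalPhenomena.PercolationContinuityZ3.Theorems.Transplant.FKDoubleFanWordCellsRimSplit
import Summits.CriticalPhenomena.PercolationContinuityZ3.Theorems.Transplant.FKDoubleFanWordCellsRoof
import HarnessLib

/-!
# Double fans `K₂ ∨ P_{m+1}`, cells of a two-block middle pattern: the polarized cells are BILINEAR, the roof legs expand in the roof
# ratio, and the 36 cells follow from the PARTS — polarized cells at pairs of the seven generators `A, D, AC, BD, 𝟙, R₀(w), R₁(w)`

Helper file (`--supports stmt-CriticalPhenomena-4575`), FK sub-lane `prim-bschramm-fk-3` (gen 49); builds on p205010 (kernel theorem, internal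
audit signed; external expert review pending).  Pure real algebra; no named facts, no sorries; standard axioms.  Memo
`bschramm/prim-bschramm-fk-3/FAR-CROSS-XXIV.md` §1.

`…WordCellsRimSplit` writes every cell `cellFn q [(r0,x1,y1),(r1,x2,y2)] r2 P S` of a two-block pattern as a Bernstein combination, in the
three rim weights, of the 27 polarized cells `pcell2 q k0 k1 k2 x1 y1 x2 y2 P S` (rim-termwise sufficiency `cellFn_twoBlocks_nonneg_of_pcells`).
This file removes the remaining generator parameters from the problem:
* the polarized cells are bilinear in the two product vectors (**`pcell2_add_left/right`**, **`pcell2_smul_left/right`**);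
* a roof leg `roofP q t w = R₀(w) + t·R₁(w) + t²(2−q)·𝟙` (`roofP_eq_expansion` of `…WordCellsRoof`) therefore expands every polarized cell with a
  roof argument into three polarized cells at `R₀(w) = roofR0 q w`, `R₁(w) = roofR1 q w` and `𝟙` (**`pcell2_roof_left`**, **`pcell2_roof_right`**),
  and a quadratic in `t ≥ 0` with non-negative coefficients is non-negative;
* hence (**`PartsOK`**, **`pcell2_nonneg_endP_of_parts`**) a polarized cell is `≥ 0` at every pair of endpoint product vectors (`IsEndP`: five rays
  and the two-parameter roofs) as soon as it is `≥ 0` at every pair of the SEVEN GENERATORS **`IsGenP`** — `A, D, AC, BD, 𝟙` and the one-parameter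
  families `R₀(w), R₁(w)`, `w ∈ [0,1]` — i.e. 49 polynomial inequalities per word `κ` in `q`, the four spokes and at most two roof probes `w, w'`;
* and (**`cellsOK_twoBlocks_of_parts`**) the parts of all 27 words give `CellsOK q [(r0,x1,y1),(r1,x2,y2)] r2` for all rim weights in `[0,1]`, hence
  (with `…WordCells`) negative correlation of the cross-apex pair at rim distance 3 for that spoke pattern.
This is the interface of the certificate campaign for `q ∈ [1/2, 1]` (memo §2: rim-termwise positivity fails below `q_T ≈ 0.423`, so for smaller `q`
the parts must be shared between words — the same polynomials, a different assembly).
[folklore]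
-/

noncomputable section

namespace Summit.CriticalPhenomena.PercolationContinuityZ3.Theorems

namespace FK

namespace ThreeApex

/-! ### Linearity of the rim letters and of the polarized cells -/

/-- The rim letters are additive. [folklore] -/
theorem rimOp_add (q : ℝ) (k : ℕ) (β γ : Biv) : rimOp q k (Biv.add β γ) = Biv.add (rimOp q k β) (rimOp q k γ) := by
  match k with
  | 0 => exact opWD_add q β γ
  | 1 => exact opTD_add q β γ
  | _ + 2 => rfl

/-- The rim letters are homogeneous. [folklore] -/
theorem rimOp_smul (q : ℝ) (k : ℕ) (c : ℝ) (β : Biv) : rimOp q k (Biv.smul c β) = Biv.smul c (rimOp q k β) := by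
  match k with
  | 0 => exact opWD_smul_biv q c β
  | 1 => exact opTD_smul_biv q c β
  | _ + 2 => rfl

/-- Additivity of a polarized cell in the input product vector. [folklore] -/
theorem pcell2_add_left (q : ℝ) (k0 k1 k2 : ℕ) (x1 y1 x2 y2 : ℝ) (P Q S : P6) :
    pcell2 q k0 k1 k2 x1 y1 x2 y2 (P6.add P Q) S = pcell2 q k0 k1 k2 x1 y1 x2 y2 P S + pcell2 q k0 k1 k2 x1 y1 x2 y2 Q S := by
  simp only [pcell2, inputBiv_add, rimOp_add, opBC_add_biv, opAC_add_biv, pairH_add_left]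

/-- Homogeneity of a polarized cell in the input product vector. [folklore] -/
theorem pcell2_smul_left (q : ℝ) (k0 k1 k2 : ℕ) (x1 y1 x2 y2 c : ℝ) (P S : P6) :
    pcell2 q k0 k1 k2 x1 y1 x2 y2 (P6.smul c P) S = c * pcell2 q k0 k1 k2 x1 y1 x2 y2 P S := by
  simp only [pcell2, inputBiv_smul, rimOp_smul, opBC_smul', opAC_smul, pairH_smul_left]

/-- Additivity of a polarized cell in the target product vector. [folklore] -/
theorem pcell2_add_right (q : ℝ) (k0 k1 k2 : ℕ) (x1 y1 x2 y2 : ℝ) (P S T : P6) :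
    pcell2 q k0 k1 k2 x1 y1 x2 y2 P (P6.add S T) = pcell2 q k0 k1 k2 x1 y1 x2 y2 P S + pcell2 q k0 k1 k2 x1 y1 x2 y2 P T := by
  simp only [pcell2, pairH, targetBiv, P6.add]; ring

/-- Homogeneity of a polarized cell in the target product vector. [folklore] -/
theorem pcell2_smul_right (q : ℝ) (k0 k1 k2 : ℕ) (x1 y1 x2 y2 c : ℝ) (P S : P6) :
    pcell2 q k0 k1 k2 x1 y1 x2 y2 P (P6.smul c S) = c * pcell2 q k0 k1 k2 x1 y1 x2 y2 P S := by
  simp only [pcell2, pairH, targetBiv, P6.smul]; ring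

/-! ### The roof expansion at the level of polarized cells -/

section Roof

variable (q : ℝ) (k0 k1 k2 : ℕ) (x1 y1 x2 y2 : ℝ)

/-- **Roof expansion on the input side**: `pcell2(roofP q t w, S) = pcell2(R₀(w), S) + t·pcell2(R₁(w), S) + t²(2−q)·pcell2(𝟙, S)`. [folklore] -/
theorem pcell2_roof_left (t w : ℝ) (S : P6) :
    pcell2 q k0 k1 k2 x1 y1 x2 y2 (roofP q t w) S =
      pcell2 q k0 k1 k2 x1 y1 x2 y2 (roofR0 q w) S + t * pcell2 q k0 k1 k2 x1 y1 x2 y2 (roofR1 q w) S +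
        t ^ 2 * (2 - q) * pcell2 q k0 k1 k2 x1 y1 x2 y2 rayOne S := by
  rw [roofP_eq_expansion, pcell2_add_left, pcell2_add_left, pcell2_smul_left, pcell2_smul_left]

/-- **Roof expansion on the target side**: `pcell2(P, roofP q t w) = pcell2(P, R₀(w)) + t·pcell2(P, R₁(w)) + t²(2−q)·pcell2(P, 𝟙)`. [folklore] -/
theorem pcell2_roof_right (P : P6) (t w : ℝ) :
    pcell2 q k0 k1 k2 x1 y1 x2 y2 P (roofP q t w) =
      pcell2 q k0 k1 k2 x1 y1 x2 y2 P (roofR0 q w) + t * pcell2 q k0 k1 k2 x1 y1 x2 y2 P (roofR1 q w) +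
        t ^ 2 * (2 - q) * pcell2 q k0 k1 k2 x1 y1 x2 y2 P rayOne := by
  rw [roofP_eq_expansion, pcell2_add_right, pcell2_add_right, pcell2_smul_right, pcell2_smul_right]

end Roof

/-- A quadratic `a + t·b + t²(2−q)·c` with `a, b, c ≥ 0` is `≥ 0` for `t ≥ 0`, `q ≤ 2`. [folklore] -/
theorem quad_roof_nonneg {q t a b c : ℝ} (hq2 : q ≤ 2) (ht : 0 ≤ t) (ha : 0 ≤ a) (hb : 0 ≤ b) (hc : 0 ≤ c) :
    0 ≤ a + t * b + t ^ 2 * (2 - q) * c := by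
  have h1 : 0 ≤ t * b := mul_nonneg ht hb
  have h2 : 0 ≤ t ^ 2 * (2 - q) * c := mul_nonneg (mul_nonneg (sq_nonneg t) (by linarith)) hc
  linarith

/-! ### The seven generators and the parts condition -/

/-- **The seven generators of the endpoint cone after the roof expansion**: the rays `A, D, AC, BD, 𝟙` and the roof parts `R₀(w)`, `R₁(w)`,
`w ∈ [0,1]`. [folklore] -/
def IsGenP (q : ℝ) (P : P6) : Prop :=
  P = rayA ∨ P = rayD ∨ P = rayAC ∨ P = rayBD ∨ P = rayOne ∨ ∃ w : ℝ, 0 ≤ w ∧ w ≤ 1 ∧ (P = roofR0 q w ∨ P = roofR1 q w)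

/-- **The parts condition of the word `κ = (k0,k1,k2)`**: its polarized cell is `≥ 0` at every pair of generators (49 polynomial inequalities in
`q`, the spokes and at most two roof probes). [folklore] -/
def PartsOK (q : ℝ) (k0 k1 k2 : ℕ) (x1 y1 x2 y2 : ℝ) : Prop :=
  ∀ P S : P6, IsGenP q P → IsGenP q S → 0 ≤ pcell2 q k0 k1 k2 x1 y1 x2 y2 P S

section Parts

variable {q : ℝ} {k0 k1 k2 : ℕ} {x1 y1 x2 y2 : ℝ}

/-- `A` is a generator. [folklore] -/
theorem isGenP_rayA (q : ℝ) : IsGenP q rayA := Or.inl rfl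
/-- `D` is a generator. [folklore] -/
theorem isGenP_rayD (q : ℝ) : IsGenP q rayD := Or.inr (Or.inl rfl)
/-- `AC` is a generator. [folklore] -/
theorem isGenP_rayAC (q : ℝ) : IsGenP q rayAC := Or.inr (Or.inr (Or.inl rfl))
/-- `BD` is a generator. [folklore] -/
theorem isGenP_rayBD (q : ℝ) : IsGenP q rayBD := Or.inr (Or.inr (Or.inr (Or.inl rfl)))
/-- `𝟙` is a generator. [folklore] -/
theorem isGenP_rayOne (q : ℝ) : IsGenP q rayOne := Or.inr (Or.inr (Or.inr (Or.inr (Or.inl rfl))))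
/-- `R₀(w)` is a generator. [folklore] -/
theorem isGenP_roofR0 (q : ℝ) {w : ℝ} (hw0 : 0 ≤ w) (hw1 : w ≤ 1) : IsGenP q (roofR0 q w) :=
  Or.inr (Or.inr (Or.inr (Or.inr (Or.inr ⟨w, hw0, hw1, Or.inl rfl⟩))))
/-- `R₁(w)` is a generator. [folklore] -/
theorem isGenP_roofR1 (q : ℝ) {w : ℝ} (hw0 : 0 ≤ w) (hw1 : w ≤ 1) : IsGenP q (roofR1 q w) :=
  Or.inr (Or.inr (Or.inr (Or.inr (Or.inr ⟨w, hw0, hw1, Or.inr rfl⟩))))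

/-- Parts at a generator against an endpoint product vector. [folklore] -/
theorem pcell2_nonneg_gen_endP (hq2 : q ≤ 2) (H : PartsOK q k0 k1 k2 x1 y1 x2 y2) {P S : P6} (hP : IsGenP q P) (hS : IsEndP q S) :
    0 ≤ pcell2 q k0 k1 k2 x1 y1 x2 y2 P S := by
  rcases hS with rfl | rfl | rfl | rfl | rfl | ⟨t, w, ht, hw0, hw1, rfl⟩
  · exact H _ _ hP (isGenP_rayA q)
  · exact H _ _ hP (isGenP_rayD q)
  · exact H _ _ hP (isGenP_rayAC q)
  · exact H _ _ hP (isGenP_rayBD q)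
  · exact H _ _ hP (isGenP_rayOne q)
  · rw [pcell2_roof_right]
    exact quad_roof_nonneg hq2 ht (H _ _ hP (isGenP_roofR0 q hw0 hw1)) (H _ _ hP (isGenP_roofR1 q hw0 hw1))
      (H _ _ hP (isGenP_rayOne q))

/-- **Parts ⟹ polarized cell at every endpoint pair** (`q ≤ 2`). [folklore] -/
theorem pcell2_nonneg_endP_of_parts (hq2 : q ≤ 2) (H : PartsOK q k0 k1 k2 x1 y1 x2 y2) {P S : P6} (hP : IsEndP q P)
    (hS : IsEndP q S) : 0 ≤ pcell2 q k0 k1 k2 x1 y1 x2 y2 P S := by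
  rcases hP with rfl | rfl | rfl | rfl | rfl | ⟨t, w, ht, hw0, hw1, rfl⟩
  · exact pcell2_nonneg_gen_endP hq2 H (isGenP_rayA q) hS
  · exact pcell2_nonneg_gen_endP hq2 H (isGenP_rayD q) hS
  · exact pcell2_nonneg_gen_endP hq2 H (isGenP_rayAC q) hS
  · exact pcell2_nonneg_gen_endP hq2 H (isGenP_rayBD q) hS
  · exact pcell2_nonneg_gen_endP hq2 H (isGenP_rayOne q) hS
  · rw [pcell2_roof_left]
    exact quad_roof_nonneg hq2 ht (pcell2_nonneg_gen_endP hq2 H (isGenP_roofR0 q hw0 hw1) hS)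
      (pcell2_nonneg_gen_endP hq2 H (isGenP_roofR1 q hw0 hw1) hS) (pcell2_nonneg_gen_endP hq2 H (isGenP_rayOne q) hS)

end Parts

/-! ### Assembly: the parts of the 27 words give the 36 cells -/

/-- **Parts ⟹ cells**: if every word `κ ∈ {0,1,2}³` satisfies its parts condition, then `CellsOK q [(r0,x1,y1),(r1,x2,y2)] r2` for all rim
weights in `[0,1]` (`q ≤ 2`). [folklore] -/
theorem cellsOK_twoBlocks_of_parts {q r0 x1 y1 r1 x2 y2 r2 : ℝ} (hq2 : q ≤ 2) (hr00 : 0 ≤ r0) (hr01 : r0 ≤ 1) (hr10 : 0 ≤ r1)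
    (hr11 : r1 ≤ 1) (hr20 : 0 ≤ r2) (hr21 : r2 ≤ 1) (H : ∀ k0 k1 k2 : ℕ, k0 ≤ 2 → k1 ≤ 2 → k2 ≤ 2 → PartsOK q k0 k1 k2 x1 y1 x2 y2) :
    CellsOK q [(r0, x1, y1), (r1, x2, y2)] r2 := by
  intro P S hP hS
  have g : ∀ k0 k1 k2 : ℕ, k0 ≤ 2 → k1 ≤ 2 → k2 ≤ 2 → 0 ≤ pcell2 q k0 k1 k2 x1 y1 x2 y2 P S :=
    fun k0 k1 k2 h0 h1 h2 => pcell2_nonneg_endP_of_parts hq2 (H k0 k1 k2 h0 h1 h2) hP hS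
  have l0 : (0:ℕ) ≤ 2 := by norm_num
  have l1 : (1:ℕ) ≤ 2 := by norm_num
  have l2 : (2:ℕ) ≤ 2 := le_rfl
  exact cellFn_twoBlocks_nonneg_of_pcells hr00 hr01 hr10 hr11 hr20 hr21
    (g 2 2 2 l2 l2 l2) (g 2 2 1 l2 l2 l1) (g 2 2 0 l2 l2 l0) (g 2 1 2 l2 l1 l2) (g 2 1 1 l2 l1 l1) (g 2 1 0 l2 l1 l0)
    (g 2 0 2 l2 l0 l2) (g 2 0 1 l2 l0 l1) (g 2 0 0 l2 l0 l0) (g 1 2 2 l1 l2 l2) (g 1 2 1 l1 l2 l1) (g 1 2 0 l1 l2 l0)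
    (g 1 1 2 l1 l1 l2) (g 1 1 1 l1 l1 l1) (g 1 1 0 l1 l1 l0) (g 1 0 2 l1 l0 l2) (g 1 0 1 l1 l0 l1) (g 1 0 0 l1 l0 l0)
    (g 0 2 2 l0 l2 l2) (g 0 2 1 l0 l2 l1) (g 0 2 0 l0 l2 l0) (g 0 1 2 l0 l1 l2) (g 0 1 1 l0 l1 l1) (g 0 1 0 l0 l1 l0)
    (g 0 0 2 l0 l0 l2) (g 0 0 1 l0 l0 l1) (g 0 0 0 l0 l0 l0)

end ThreeApex

end FK

end Summit.CriticalPhenomena.PercolationContinuityZ3.Theorems
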